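import Summits.QuantumAdvantage.QuantumAdvantage.Theses.CubicForrelation
import Summits.QuantumAdvantage.QuantumAdvantage.Theorems.CubicForrelationNearExactIsExactEightFlatRM
import Summits.QuantumAdvantage.QuantumAdvantage.Theorems.NearExactIsExact.Negative.MmPairFixedPoints

/-!
# `NearExactIsExact` (stmt-QuantumAdvantage-14043) — negative lemma BQQ(7):
  bijective Maiorana–McFarland cubic pairs at `n = 14` have `Φ = 1` or `Φ ≤ 7/8`

**What.** `Negative.MmPairFixedPoints` reduces the forrelation of a two-sided Maiorana–McFarland pair
(`(-1)^{g(y₁‖y₂)} = (-1)^{y₁·π(y₂)+h(y₂)}`, `(-1)^{f(x₁‖x₂)} = (-1)^{x₂·τ(x₁)+r(x₁)}`) with `τ ∘ π = id` to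
`Φ = 2^{-m} Σ_y (-1)^{h(y) ⊕ r(π y)} = 1 − 2·wt(h ⊕ r∘π)/2^m`, and records that this bijective sub-case is NOT
closed off by counting: one needs the minimum distance between the cubic codes `RM(3,m)` and `RM(3,m)∘π`
(conjecturally `2^{m−4}`, "BQQ"; rigorously only Hou's bound before this file).  Here we prove the case
`m = 7` exactly:

* `bqq_seven` — for `π, τ : 𝔽₂⁷ → 𝔽₂⁷` of algebraic degree `≤ 2` with `τ ∘ π = id` and cubic `c₁, c₂`, the
  word `c₁ ⊕ c₂∘π` is `0` or has weight `≥ 8` (sharp);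
* `forrelation_bijectiveMm_fourteen` — hence such pairs on `14` bits have `Φ = 1` or `Φ ≤ 7/8`
  (nothing in `(7/8, 1)`; Hou's theorem gives only `15/16`).

**Proof.** Let `S = supp (c₁ ⊕ c₂∘π)`, `k = |S|`.
(1) *Parity* (`bq_par`): for `ℓ₀, ℓ₁` of degree `≤ 1`, `|{y ∈ S : ℓ₀(y) = 1 = ℓ₁(π y)}|` is even, because
`(c₁ ⊕ c₂∘π)·ℓ₀·(ℓ₁∘π) = c₁·ℓ₀·(ℓ₁∘π) ⊕ (c₂·(ℓ₀∘τ)·ℓ₁)∘π` and both `c₁ℓ₀(ℓ₁∘π)`, `c₂(ℓ₀∘τ)ℓ₁` have degree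
`≤ 3 + 1 + 2 = 6 < 7`, hence even weight (Ax/McEliece on the full cube, `stub_axParity`; `π` is a bijection).
(2) *Rank* (`matX_transpose_mul_matY`, `rank_add_rank_le`): with `X, Y ∈ 𝔽₂^{S×8}` the matrices of rows
`(1, y)` and `(1, π y)`, (1) applied to the constant and coordinate functionals says `Xᵀ Y = 0`, so
`rank X + rank Y ≤ k` (range `Y` ≤ ker `Xᵀ`, rank–nullity, `rank Xᵀ = rank X`).
(3) *Span* (`card_le_two_pow_finrank_sub_one`): `k` distinct vectors with first coordinate `1` inside a
subspace `W` number at most `2^{dim W − 1}` (translate by one of them into the proper subspace `W ∩ {w₀ = 0}`,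
`|W₀| = 2^{dim W₀}`), so `k ≤ 2^{rank X − 1}` and, `π` being injective, `k ≤ 2^{rank Y − 1}`.
For `k` even (`ℓ₀ = ℓ₁ = 1` in (1)) and `1 ≤ k ≤ 7` these three facts are contradictory (`core`).

Honest framing (b2b cell): a theorem about the value landscape of cubic Maiorana–McFarland pairs —
negative knowledge for the crux `NearExactIsExact`, not progress on the summit.

References (orientation; everything is proved here from the tree and Mathlib): X.-D. Hou, *GL(m,2) acting on
R(r,m)/R(r−1,m)*, Discrete Math. 149 (1996) (degree of the dual of a cubic bent function); R. L. McFarland,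
JCTA 15 (1973); F. J. MacWilliams, N. J. A. Sloane, *The Theory of Error-Correcting Codes* (1977), Ch. 13, 15
(Reed–Muller codes, McEliece's theorem); C. Carlet, *Boolean Functions for Cryptography and Coding Theory*
(CUP 2020), §4.1.  Mathlib: `Matrix.rank_transpose`, `Matrix.rank_eq_finrank_span_cols`,
`LinearMap.finrank_range_add_finrank_ker`, `Module.card_eq_pow_finrank`.
-/

set_option linter.dupNamespace false -- D-0017: single-problem summit ⇒ `QuantumAdvantage.QuantumAdvantage` by design

noncomputable section

namespace Summit.QuantumAdvantage.QuantumAdvantage.Theorems.NearExactIsExact.Negative.BqqSeven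

open Finset
open scoped Matrix
open Literature.Computability.QuantumComplexity
open Summit.QuantumAdvantage.QuantumAdvantage.Theorems.CubicForrelation.NearExactIsExact
  (stub_axParity fc_sum_signOf_eq_card te_isDegLeFun_band fc_isDegLeFun_comp fc_deg_bxor erm_even_card_xor)
open Summit.QuantumAdvantage.QuantumAdvantage.Theorems.NearExactIsExact.Negative.MmPairFixedPoints
  (forrelation_mmPair_of_leftInverse)

/-! ### Weights of `RM(6,7)` are even -/

/-- A Boolean function of algebraic degree `≤ 6` on `7` bits takes the value `true` an even number of
times (Ax / McEliece on the full cube: `Σ_x (−1)^{F(x)} = 2⁷ − 2·wt(F) ∈ 2^{⌈7/6⌉}ℤ = 4ℤ`). [folklore] -/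
theorem bq_even_card_of_deg_six {F : (Fin 7 → Bool) → Bool} (hF : IsDegLeFun 6 F) :
    Even ((univ.filter fun x : Fin 7 → Bool => F x = true).card) := by
  obtain ⟨z, hz⟩ := stub_axParity 7 6 F univ (by norm_num) hF
  rw [filter_true_of_mem (fun u _ i _ => mem_univ i), card_fin, fc_sum_signOf_eq_card] at hz
  have h4 : (2 : ℝ) ^ ((7 + 6 - 1) / 6) = 4 := by norm_num
  rw [h4] at hz
  have hc : (((univ.filter fun x : Fin 7 → Bool => F x = true).card : ℤ) : ℝ) = ((2 * (32 - z) : ℤ) : ℝ) := by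
    push_cast
    linear_combination (-(1 : ℝ) / 2) * hz
  have he : Even (((univ.filter fun x : Fin 7 → Bool => F x = true).card : ℤ)) :=
    ⟨32 - z, by rw [Int.cast_injective hc]; ring⟩
  exact (Int.even_coe_nat _).mp he

/-! ### Step (1): parity of the `ℓ₀ · (ℓ₁ ∘ π)`-sections of the support of a word `c₁ ⊕ c₂∘π` -/

/-- Counting through a bijection: `#{y : G (π y)} = #{x : G x}`. [folklore] -/
theorem bq_card_filter_comp {α : Type*} [Fintype α] (π : α → α) (hπ : Function.Bijective π)
    (G : α → Bool) :
    (univ.filter fun y => G (π y) = true).card = (univ.filter fun x => G x = true).card := by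
  rw [card_filter, card_filter]
  exact Fintype.sum_bijective π hπ _ _ fun _ => rfl

/-- **PAR.** For mutually inverse maps `π, τ` of `𝔽₂⁷` of degree `≤ 2`, cubic `c₁, c₂` and `ℓ₀, ℓ₁` of
degree `≤ 1`, the number of `y` with `c₁(y) ≠ c₂(π y)`, `ℓ₀(y) = 1` and `ℓ₁(π y) = 1` is even:
`(c₁ ⊕ c₂∘π)·ℓ₀·(ℓ₁∘π) = c₁ℓ₀(ℓ₁∘π) ⊕ (c₂·(ℓ₀∘τ)·ℓ₁)∘π`, two functions of degree `≤ 6 < 7`. [folklore] -/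
theorem bq_par (π τ : (Fin 7 → Bool) → (Fin 7 → Bool))
    (hπ : ∀ i, IsDegLeFun 2 (fun y => π y i)) (hτ : ∀ i, IsDegLeFun 2 (fun x => τ x i))
    (hτπ : ∀ y, τ (π y) = y) (hπτ : ∀ x, π (τ x) = x)
    (c₁ c₂ : (Fin 7 → Bool) → Bool) (h₁ : IsDegLeFun 3 c₁) (h₂ : IsDegLeFun 3 c₂)
    (ℓ₀ ℓ₁ : (Fin 7 → Bool) → Bool) (hℓ₀ : IsDegLeFun 1 ℓ₀) (hℓ₁ : IsDegLeFun 1 ℓ₁) :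
    Even ((univ.filter fun y : Fin 7 → Bool =>
      ((c₁ y ^^ c₂ (π y)) && (ℓ₀ y && ℓ₁ (π y))) = true).card) := by
  have hbij : Function.Bijective π :=
    ⟨fun a b hab => by rw [← hτπ a, ← hτπ b, hab], fun x => ⟨τ x, hπτ x⟩⟩
  -- split the xor
  have e : ∀ y : Fin 7 → Bool, ((c₁ y ^^ c₂ (π y)) && (ℓ₀ y && ℓ₁ (π y))) =
      ((c₁ y && (ℓ₀ y && ℓ₁ (π y))) ^^ (c₂ (π y) && (ℓ₀ (τ (π y)) && ℓ₁ (π y)))) := by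
    intro y
    rw [hτπ y]
    cases c₁ y <;> cases c₂ (π y) <;> cases ℓ₀ y <;> cases ℓ₁ (π y) <;> rfl
  simp_rw [e]
  refine erm_even_card_xor _ _ (Even.add ?_ ?_)
  · -- degree of `c₁ · ℓ₀ · (ℓ₁ ∘ π)` is ≤ 3 + (1 + 2)
    refine bq_even_card_of_deg_six ?_
    have hℓ₁π : IsDegLeFun 2 (fun y : Fin 7 → Bool => ℓ₁ (π y)) :=
      fc_isDegLeFun_comp hℓ₁ π hπ (by norm_num)
    exact te_isDegLeFun_band h₁ (te_isDegLeFun_band hℓ₀ hℓ₁π)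
  · -- reindex by `π`, then degree of `c₂ · (ℓ₀ ∘ τ) · ℓ₁` is ≤ 3 + (2 + 1)
    rw [bq_card_filter_comp π hbij (fun x => c₂ x && (ℓ₀ (τ x) && ℓ₁ x))]
    refine bq_even_card_of_deg_six ?_
    have hℓ₀τ : IsDegLeFun 2 (fun x : Fin 7 → Bool => ℓ₀ (τ x)) :=
      fc_isDegLeFun_comp hℓ₀ τ hτ (by norm_num)
    exact te_isDegLeFun_band h₂ (te_isDegLeFun_band hℓ₀τ hℓ₁)

/-! ### Step (2): the matrices `X = (1, y)_{y ∈ S}`, `Y = (1, π y)_{y ∈ S}` over `𝔽₂` and `Xᵀ Y = 0` -/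

/-! Conventions (kept inline so that this file declares no definitions or notation): "`(1, y)`" is the vector
`Fin.cons 1 (fun j => [y j]) : Fin 8 → 𝔽₂`; "`crd i`" is the `i`-th coordinate functional of `(1, y)`,
`Fin.cons (fun _ => true) (fun j y => y j) i` (`crd 0 ≡ 1`, `crd (j+1) y = y j`); "`X`", "`Y`" are the
`S × 8` matrices `Matrix.of fun s i => (1, s) i` and `Matrix.of fun s i => (1, π s) i`. -/

/-- `(1, y)_i = [crd_i(y)]`. -/
theorem vec1_apply (y : Fin 7 → Bool) (i : Fin 8) : (Fin.cons (1 : ZMod 2) (fun j : Fin 7 => if y j then (1 : ZMod 2) else 0) : Fin 8 → ZMod 2) i = if ((Fin.cons (fun _ => true) (fun (j : Fin 7) (y : Fin 7 → Bool) => y j) : Fin 8 → (Fin 7 → Bool) → Bool) i) y = true then 1 else 0 := by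
  refine Fin.cases ?_ (fun j => ?_) i
  · simp
  · simp

/-- The first coordinate of `(1, y)` is `1`. -/
theorem vec1_zero (y : Fin 7 → Bool) : (Fin.cons (1 : ZMod 2) (fun j : Fin 7 => if y j then (1 : ZMod 2) else 0) : Fin 8 → ZMod 2) 0 = 1 := by
  simp

/-- The coordinate functionals have degree `≤ 1`. -/
theorem crd_deg (i : Fin 8) : IsDegLeFun 1 ((Fin.cons (fun _ => true) (fun (j : Fin 7) (y : Fin 7 → Bool) => y j) : Fin 8 → (Fin 7 → Bool) → Bool) i) := by
  refine Fin.cases ?_ (fun j => ?_) i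
  · simpa using (isDegLeFun_const (n := 7) 1 true)
  · simpa using (isDegLeFun_apply (n := 7) j (d := 1) le_rfl)

/-- `y ↦ (1, y)` is injective. -/
theorem vec1_injective : Function.Injective (fun y : Fin 7 → Bool => (Fin.cons (1 : ZMod 2) (fun j : Fin 7 => if y j then (1 : ZMod 2) else 0) : Fin 8 → ZMod 2)) := by
  intro y y' h
  funext j
  have := congrFun h j.succ
  simp only [Fin.cons_succ] at this
  have h10 : (1 : ZMod 2) ≠ 0 := by decide
  cases hy : y j <;> cases hy' : y' j <;> simp_all

/-- A natural number cast to `𝔽₂` vanishes when it is even. [folklore] -/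
theorem natCast_eq_zero_of_even {n : ℕ} (h : Even n) : (n : ZMod 2) = 0 := by
  rw [← ZMod.natCast_mod n 2, Nat.even_iff.mp h, Nat.cast_zero]

section Rank

variable (S : Finset (Fin 7 → Bool)) (π : (Fin 7 → Bool) → (Fin 7 → Bool))

/-- `Xᵀ Y = 0` over `𝔽₂` when all the section counts `|{y ∈ S : crd i y = 1 = crd j (π y)}|` are even. -/
theorem matX_transpose_mul_matY
    (hpar : ∀ i j : Fin 8, Even ((S.filter fun y => (((Fin.cons (fun _ => true) (fun (j : Fin 7) (y : Fin 7 → Bool) => y j) : Fin 8 → (Fin 7 → Bool) → Bool) i) y && ((Fin.cons (fun _ => true) (fun (j : Fin 7) (y : Fin 7 → Bool) => y j) : Fin 8 → (Fin 7 → Bool) → Bool) j) (π y)) = true).card)) :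
    ((Matrix.of fun (s : ↥S) (i : Fin 8) => (Fin.cons (1 : ZMod 2) (fun j : Fin 7 => if s.1 j then (1 : ZMod 2) else 0) : Fin 8 → ZMod 2) i : Matrix ↥S (Fin 8) (ZMod 2)))ᵀ * (Matrix.of fun (s : ↥S) (i : Fin 8) => (Fin.cons (1 : ZMod 2) (fun j : Fin 7 => if π s.1 j then (1 : ZMod 2) else 0) : Fin 8 → ZMod 2) i : Matrix ↥S (Fin 8) (ZMod 2)) = 0 := by
  ext i j
  rw [Matrix.mul_apply, Matrix.zero_apply]
  have e : ∀ s : S, ((Matrix.of fun (s : ↥S) (i : Fin 8) => (Fin.cons (1 : ZMod 2) (fun j : Fin 7 => if s.1 j then (1 : ZMod 2) else 0) : Fin 8 → ZMod 2) i : Matrix ↥S (Fin 8) (ZMod 2)))ᵀ i s * (Matrix.of fun (s : ↥S) (i : Fin 8) => (Fin.cons (1 : ZMod 2) (fun j : Fin 7 => if π s.1 j then (1 : ZMod 2) else 0) : Fin 8 → ZMod 2) i : Matrix ↥S (Fin 8) (ZMod 2)) s j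
      = if (((Fin.cons (fun _ => true) (fun (j : Fin 7) (y : Fin 7 → Bool) => y j) : Fin 8 → (Fin 7 → Bool) → Bool) i) s.1 && ((Fin.cons (fun _ => true) (fun (j : Fin 7) (y : Fin 7 → Bool) => y j) : Fin 8 → (Fin 7 → Bool) → Bool) j) (π s.1)) = true then 1 else 0 := by
    intro s
    simp only [Matrix.transpose_apply, Matrix.of_apply, vec1_apply]
    cases ((Fin.cons (fun _ => true) (fun (j : Fin 7) (y : Fin 7 → Bool) => y j) : Fin 8 → (Fin 7 → Bool) → Bool) i) s.1 <;> cases ((Fin.cons (fun _ => true) (fun (j : Fin 7) (y : Fin 7 → Bool) => y j) : Fin 8 → (Fin 7 → Bool) → Bool) j) (π s.1) <;> simp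
  rw [sum_congr rfl fun s _ => e s]
  have hsum : ∑ s : S, (if (((Fin.cons (fun _ => true) (fun (j : Fin 7) (y : Fin 7 → Bool) => y j) : Fin 8 → (Fin 7 → Bool) → Bool) i) s.1 && ((Fin.cons (fun _ => true) (fun (j : Fin 7) (y : Fin 7 → Bool) => y j) : Fin 8 → (Fin 7 → Bool) → Bool) j) (π s.1)) = true then (1 : ZMod 2) else 0)
      = ((S.filter fun y => (((Fin.cons (fun _ => true) (fun (j : Fin 7) (y : Fin 7 → Bool) => y j) : Fin 8 → (Fin 7 → Bool) → Bool) i) y && ((Fin.cons (fun _ => true) (fun (j : Fin 7) (y : Fin 7 → Bool) => y j) : Fin 8 → (Fin 7 → Bool) → Bool) j) (π y)) = true).card : ZMod 2) := by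
    rw [card_filter, Nat.cast_sum, ← sum_coe_sort S]
    refine sum_congr rfl fun s _ => ?_
    split_ifs <;> simp
  rw [hsum]
  exact natCast_eq_zero_of_even (hpar i j)

/-- Sylvester: `Xᵀ Y = 0` forces `rank X + rank Y ≤ |S|`. [folklore] -/
theorem rank_add_rank_le (X Y : Matrix S (Fin 8) (ZMod 2)) (h : Xᵀ * Y = 0) :
    X.rank + Y.rank ≤ S.card := by
  have hle : LinearMap.range Y.mulVecLin ≤ LinearMap.ker Xᵀ.mulVecLin := by
    rw [LinearMap.range_le_ker_iff, ← Matrix.mulVecLin_mul, h]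
    ext v i
    simp
  have h1 := LinearMap.finrank_range_add_finrank_ker Xᵀ.mulVecLin
  rw [Module.finrank_fintype_fun_eq_card, Fintype.card_coe] at h1
  have h2 := Submodule.finrank_mono hle
  rw [← Matrix.rank_transpose X]
  unfold Matrix.rank
  omega

/-- Row rank: `rank X = dim span (rows of X)`. [folklore] -/
theorem rank_eq_finrank_span_rows (X : Matrix S (Fin 8) (ZMod 2)) :
    X.rank = Module.finrank (ZMod 2) (Submodule.span (ZMod 2) (Set.range X)) := by
  rw [← Matrix.rank_transpose X, Matrix.rank_eq_finrank_span_cols]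
  rfl

end Rank

/-! ### Step (3): `k` distinct vectors with first coordinate `1` span dimension `≥ 1 + log₂ k` -/

/-- If a finite set `T` of vectors with `t 0 = 1` lies in a subspace `W ≤ 𝔽₂⁸`, then `|T| ≤ 2^{dim W − 1}`:
translating by a fixed `t₀ ∈ T` embeds `T` into the proper subspace `W ∩ {w 0 = 0}`. [folklore] -/
theorem card_le_two_pow_finrank_sub_one (W : Submodule (ZMod 2) (Fin 8 → ZMod 2))
    (T : Finset (Fin 8 → ZMod 2)) (hTW : ∀ t ∈ T, t ∈ W) (hT0 : ∀ t ∈ T, t 0 = 1) :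
    T.card ≤ 2 ^ (Module.finrank (ZMod 2) W - 1) := by
  classical
  rcases T.eq_empty_or_nonempty with hT | ⟨t₀, ht₀⟩
  · simp [hT]
  let W₀ : Submodule (ZMod 2) (Fin 8 → ZMod 2) := W ⊓ LinearMap.ker (LinearMap.proj 0)
  have hW₀W : W₀ < W := by
    refine lt_of_le_of_ne inf_le_left fun hEq => ?_
    have : t₀ ∈ W₀ := hEq ▸ hTW t₀ ht₀
    have h0 : t₀ 0 = 0 := by
      have := (Submodule.mem_inf.mp this).2
      simpa [LinearMap.mem_ker] using this
    rw [hT0 t₀ ht₀] at h0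
    exact absurd h0 (by decide)
  have hfin : Module.finrank (ZMod 2) W₀ < Module.finrank (ZMod 2) W :=
    Submodule.finrank_lt_finrank_of_lt hW₀W
  -- `T + t₀ ⊆ W₀`
  have hsub : ∀ t ∈ T, t + t₀ ∈ W₀ := by
    intro t ht
    refine Submodule.mem_inf.mpr ⟨W.add_mem (hTW t ht) (hTW t₀ ht₀), ?_⟩
    rw [LinearMap.mem_ker, LinearMap.proj_apply, Pi.add_apply, hT0 t ht, hT0 t₀ ht₀]
    decide
  have hcardW₀ : Fintype.card W₀ = 2 ^ Module.finrank (ZMod 2) W₀ := by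
    rw [Module.card_eq_pow_finrank (K := ZMod 2), ZMod.card]
  have hcount : T.card ≤ Fintype.card W₀ := by
    rw [Fintype.card_of_subtype (univ.filter fun v : Fin 8 → ZMod 2 => v ∈ W₀) (fun v => by simp)]
    rw [← card_image_of_injective T (add_left_injective t₀)]
    refine card_le_card fun v hv => ?_
    rw [mem_image] at hv
    obtain ⟨t, ht, rfl⟩ := hv
    simpa using hsub t ht
  calc T.card ≤ Fintype.card W₀ := hcount
    _ = 2 ^ Module.finrank (ZMod 2) W₀ := hcardW₀
    _ ≤ 2 ^ (Module.finrank (ZMod 2) W - 1) := Nat.pow_le_pow_right (by norm_num) (by omega)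

/-! ### The combinatorial core and THEOREM BQQ(7) -/

/-- **Core.** If `π` is injective on `S ⊆ 𝔽₂⁷` and all section counts `|{y ∈ S : crd i y = 1 = crd j (π y)}|`
(`i, j ∈ {0,…,7}`, `crd[0] ≡ 1`) are even, then `S = ∅` or `|S| ≥ 8` (rank count, DISPROOF §14.5 (2)–(3)). [folklore] -/
theorem core (S : Finset (Fin 7 → Bool)) (π : (Fin 7 → Bool) → (Fin 7 → Bool)) (hinj : Function.Injective π)
    (hpar : ∀ i j : Fin 8, Even ((S.filter fun y => (((Fin.cons (fun _ => true) (fun (j : Fin 7) (y : Fin 7 → Bool) => y j) : Fin 8 → (Fin 7 → Bool) → Bool) i) y && ((Fin.cons (fun _ => true) (fun (j : Fin 7) (y : Fin 7 → Bool) => y j) : Fin 8 → (Fin 7 → Bool) → Bool) j) (π y)) = true).card)) :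
    S = ∅ ∨ 8 ≤ S.card := by
  classical
  rcases S.eq_empty_or_nonempty with hS | hne
  · exact Or.inl hS
  right
  by_contra hlt
  rw [not_le] at hlt
  -- k is even (i = j = 0)
  have hk_even : Even S.card := by
    have := hpar 0 0
    simpa using this
  have hk_pos : 0 < S.card := card_pos.mpr hne
  -- ranks
  set a := ((Matrix.of fun (s : ↥S) (i : Fin 8) => (Fin.cons (1 : ZMod 2) (fun j : Fin 7 => if s.1 j then (1 : ZMod 2) else 0) : Fin 8 → ZMod 2) i : Matrix ↥S (Fin 8) (ZMod 2))).rank with ha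
  set b := ((Matrix.of fun (s : ↥S) (i : Fin 8) => (Fin.cons (1 : ZMod 2) (fun j : Fin 7 => if π s.1 j then (1 : ZMod 2) else 0) : Fin 8 → ZMod 2) i : Matrix ↥S (Fin 8) (ZMod 2))).rank with hb
  have hab : a + b ≤ S.card := rank_add_rank_le S _ _ (matX_transpose_mul_matY S π hpar)
  -- k ≤ 2^(a-1)
  have hka : S.card ≤ 2 ^ (a - 1) := by
    rw [ha, rank_eq_finrank_span_rows, ← card_image_of_injective S vec1_injective]
    refine card_le_two_pow_finrank_sub_one _ _ (fun t ht => ?_) (fun t ht => ?_)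
    · rw [mem_image] at ht
      obtain ⟨y, hy, rfl⟩ := ht
      exact Submodule.subset_span ⟨⟨y, hy⟩, rfl⟩
    · rw [mem_image] at ht
      obtain ⟨y, hy, rfl⟩ := ht
      exact vec1_zero y
  -- k ≤ 2^(b-1)
  have hkb : S.card ≤ 2 ^ (b - 1) := by
    rw [hb, rank_eq_finrank_span_rows,
      ← card_image_of_injective S (vec1_injective.comp hinj)]
    refine card_le_two_pow_finrank_sub_one _ _ (fun t ht => ?_) (fun t ht => ?_)
    · rw [mem_image] at ht
      obtain ⟨y, hy, rfl⟩ := ht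
      exact Submodule.subset_span ⟨⟨y, hy⟩, rfl⟩
    · rw [mem_image] at ht
      obtain ⟨y, hy, rfl⟩ := ht
      exact vec1_zero (π y)
  -- arithmetic: k ∈ {2,4,6}, a + b ≤ k, k ≤ 2^(a-1), k ≤ 2^(b-1) is impossible
  have ha7 : a ≤ 7 := by omega
  have hb7 : b ≤ 7 := by omega
  obtain ⟨t, ht⟩ := hk_even
  interval_cases a <;> interval_cases b <;> simp only [Nat.reducePow, Nat.reduceSub, pow_zero] at hka hkb <;> omega

/-- **THEOREM BQQ(7).** For mutually inverse maps `π, τ : 𝔽₂⁷ → 𝔽₂⁷` of algebraic degree `≤ 2` (it suffices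
that `τ ∘ π = id`) and cubic `c₁, c₂`, the word `c₁ ⊕ c₂∘π` of the code `RM(3,7) + RM(3,7)∘π` is either `0` or
has weight `≥ 8 = 2^{7−4}` (DISPROOF §14.5; sharp: 3-flat words exist for transvections). [folklore] -/
theorem bqq_seven (π τ : (Fin 7 → Bool) → (Fin 7 → Bool))
    (hπ : ∀ i, IsDegLeFun 2 (fun y => π y i)) (hτ : ∀ i, IsDegLeFun 2 (fun x => τ x i))
    (hτπ : ∀ y, τ (π y) = y)
    (c₁ c₂ : (Fin 7 → Bool) → Bool) (h₁ : IsDegLeFun 3 c₁) (h₂ : IsDegLeFun 3 c₂) :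
    (∀ y, c₁ y = c₂ (π y)) ∨ 8 ≤ (univ.filter fun y => (c₁ y ^^ c₂ (π y)) = true).card := by
  classical
  have hinj : Function.Injective π := fun a b hab => by rw [← hτπ a, ← hτπ b, hab]
  have hsurj : Function.Surjective π := Finite.surjective_of_injective hinj
  have hπτ : ∀ x, π (τ x) = x := fun x => by
    obtain ⟨y, rfl⟩ := hsurj x
    rw [hτπ]
  set S := univ.filter fun y => (c₁ y ^^ c₂ (π y)) = true with hS
  have hpar : ∀ i j : Fin 8, Even ((S.filter fun y => (((Fin.cons (fun _ => true) (fun (j : Fin 7) (y : Fin 7 → Bool) => y j) : Fin 8 → (Fin 7 → Bool) → Bool) i) y && ((Fin.cons (fun _ => true) (fun (j : Fin 7) (y : Fin 7 → Bool) => y j) : Fin 8 → (Fin 7 → Bool) → Bool) j) (π y)) = true).card) := by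
    intro i j
    have key := bq_par π τ hπ hτ hτπ hπτ c₁ c₂ h₁ h₂ ((Fin.cons (fun _ => true) (fun (j : Fin 7) (y : Fin 7 → Bool) => y j) : Fin 8 → (Fin 7 → Bool) → Bool) i) ((Fin.cons (fun _ => true) (fun (j : Fin 7) (y : Fin 7 → Bool) => y j) : Fin 8 → (Fin 7 → Bool) → Bool) j) (crd_deg i) (crd_deg j)
    have hset : S.filter (fun y => (((Fin.cons (fun _ => true) (fun (j : Fin 7) (y : Fin 7 → Bool) => y j) : Fin 8 → (Fin 7 → Bool) → Bool) i) y && ((Fin.cons (fun _ => true) (fun (j : Fin 7) (y : Fin 7 → Bool) => y j) : Fin 8 → (Fin 7 → Bool) → Bool) j) (π y)) = true)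
        = univ.filter (fun y => ((c₁ y ^^ c₂ (π y)) && (((Fin.cons (fun _ => true) (fun (j : Fin 7) (y : Fin 7 → Bool) => y j) : Fin 8 → (Fin 7 → Bool) → Bool) i) y && ((Fin.cons (fun _ => true) (fun (j : Fin 7) (y : Fin 7 → Bool) => y j) : Fin 8 → (Fin 7 → Bool) → Bool) j) (π y))) = true) := by
      rw [hS, filter_filter]
      refine filter_congr fun y _ => ?_
      simp only [Bool.and_eq_true]
    rw [hset]
    exact key
  rcases core S π hinj hpar with h0 | h8
  · left
    intro y
    have hy := filter_eq_empty_iff.mp h0 (mem_univ y)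
    cases hc₁ : c₁ y <;> cases hc₂ : c₂ (π y) <;> simp_all
  · exact Or.inr h8

/-- **Corollary (bijective Maiorana–McFarland pairs at `n = 14`).** If `g(y₁‖y₂)` has sign
`(−1)^{y₁·π(y₂)} (−1)^{h(y₂)}` and `f(x₁‖x₂)` has sign `(−1)^{x₂·τ(x₁)} (−1)^{r(x₁)}` with `π, τ` of degree `≤ 2`,
`τ ∘ π = id` and `h, r` cubic (so `f, g` are cubic Maiorana–McFarland functions — the bent sub-case), then
`Φ(f, g) = 1` or `Φ(f, g) ≤ 7/8`: by `forrelation_mmPair_of_leftInverse`, `Φ = 1 − 2·wt(h ⊕ r∘π)/2⁷`, and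
`wt ∈ {0} ∪ [8, ∞)` by `bqq_seven`.  In particular no such pair has `Φ ∈ (7/8, 1)`, improving the bound
`15/16` from Hou's theorem; with the fixed-point bound of `MmPairFixedPoints` for `τ ∘ π ≠ id` this is the
`n = 14` Maiorana–McFarland landscape relevant to `NearExactIsExact`. [folklore] -/
theorem forrelation_bijectiveMm_fourteen (f g : (Fin (7 + 7) → Bool) → Bool)
    (π τ : (Fin 7 → Bool) → (Fin 7 → Bool)) (h r : (Fin 7 → Bool) → Bool)
    (hg : ∀ y₁ y₂ : Fin 7 → Bool, signOf (g (Fin.append y₁ y₂)) = twist y₁ (π y₂) * signOf (h y₂))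
    (hf : ∀ x₁ x₂ : Fin 7 → Bool, signOf (f (Fin.append x₁ x₂)) = twist x₂ (τ x₁) * signOf (r x₁))
    (hπ : ∀ i, IsDegLeFun 2 (fun y => π y i)) (hτ : ∀ i, IsDegLeFun 2 (fun x => τ x i))
    (hτπ : ∀ y, τ (π y) = y) (hh : IsDegLeFun 3 h) (hr : IsDegLeFun 3 r) :
    forrelation f g = 1 ∨ forrelation f g ≤ 7 / 8 := by
  classical
  rw [forrelation_mmPair_of_leftInverse f g π τ h r hg hf hτπ]
  have e : ∀ y : Fin 7 → Bool, signOf (h y) * signOf (r (π y)) = signOf (h y ^^ r (π y)) := fun y => by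
    cases h y <;> cases r (π y) <;> simp [signOf]
  simp_rw [e]
  rw [fc_sum_signOf_eq_card]
  have h128 : ((2 : ℝ) ^ 7)⁻¹ = 1 / 128 := by norm_num
  rw [h128]
  rcases bqq_seven π τ hπ hτ hτπ h r hh hr with h0 | h8
  · left
    have hempty : (univ.filter fun y : Fin 7 → Bool => (h y ^^ r (π y)) = true) = ∅ :=
      filter_eq_empty_iff.mpr fun y _ => by rw [h0 y]; simp
    rw [hempty, card_empty, Nat.cast_zero]
    norm_num
  · right
    have h8' : (8 : ℝ) ≤ ((univ.filter fun y : Fin 7 → Bool => (h y ^^ r (π y)) = true).card : ℝ) := by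
      exact_mod_cast h8
    linarith

end Summit.QuantumAdvantage.QuantumAdvantage.Theorems.NearExactIsExact.Negative.BqqSeven
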